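import Summits.QuantumFields.YangMills.Theorems.UnitScaleTiltProp7SectET3Transport
import Literature.MathematicalPhysics.QuantumFieldTheory.Balaban1983to89.B7Eq78Linearization
import HarnessLib

/-!
# `UnitScaleTiltProp7SectET3NablaDict` — THE DICTIONARY BETWEEN `B11Eq115Space`'S `nabla115 η U₀` AT THE T³ BACKGROUND AND THE ROUTE'S OWN COVARIANT-DERIVATIVE
# LETTER (route `UnitScaleTilt`, crux K1 «MinimiserStabilityRegPr» stmt-QuantumFields-19200, stub `stub_existenceMinimalOrbit`, route (α), (S2); OWNER ym3-torus-plan g25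
# 2026-08-28T02:01:27Z: «the one conversion between ★w2-19200 g2's (14)-current row and the (115) letters»; def-free, count-neutral)

Cell `ym3-torus` (HUMAN RULING D-0037, YM ladder rung R3 — YM₃ on T³ is a rung, not d = 4, not a mass gap, not Clay).

THE TWO LETTERS, BINDERS READ.  [B11]∕[B9]: `B11Eq111FrakG.nabla115 η U₀ = covGrad (η⁻¹) (adTransport U₀)`, read by `nabla115_apply` as
`(∇A)((y, μ), ν) = η⁻¹ · (U₀(y,μ) · A(btgt (y,μ), ν) · U₀(y,μ)⁻¹ − A(y, ν))` — the derivative ALONG THE BOND `(y, μ)` of the COMPONENT `ν`, index in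
`Bond d Pd × Fin d` ([Balaban1985BackgroundPropagators] (3.3) p.391 inside [Balaban1985Variational] (115) p.294).  ROUTE (p1 `…Prop7CovariantCoercivity.
sum_normSq_le_covGrad_of_covLineAvg_eq_zero_T3`, right-hand side; `…CovariantBlockPoincare`): `conjR (unitsField (toUField U₀) ⟨b.src, ν⟩) (Y ⟨b.src.shift ν, b.dir⟩) − Y b`
with `B7Eq78Linearization.conjR X Y = X · Y · X⁻¹` — the derivative ALONG `ν` of the COMPONENT bond `b`, index in `PBond (F.P K) 0 × Fin 3`, UNIT-LATTICE spelling (no `η⁻¹`).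
VERDICT (LOCATED ✓ with two explicit conversions, no hidden convention): SAME left action `U·(·)·U⁻¹`, SAME sign, SAME adjoint placement; they differ EXACTLY by
(i) the scalar `η⁻¹` (print's `X = ηA`, (S0)-B (t3)) and (ii) the INDEX SWAP `(b, ν) ↦ ((e b.src, ν), b.dir)` (bond of differentiation first in [B11], component first
in the route).  This file lands both as identities:
* §1 pointwise: **`nabla115_lambda_pullback_apply`** (abstract chart `e` with shift-compatibility `he`, any `SU(N)`, any lattice `P, j` — the form ★w2-19200 g2's
  objects file types), **`nabla115_bgOfCfg_cfgEquiv`** (the chart of record `siteEquiv F K`, the OWNER's named row) and its `Bond`-indexed form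
  `nabla115_bgOfCfg_cfgEquiv_apply`, the `η`-cleared form `eta_smul_nabla115_bgOfCfg_cfgEquiv`;
* §2 sums and sups: **`sum_normSq_nabla115_cfgEquiv`** (`Σ_q ‖∇((q))‖² = η⁻² · Σ_b Σ_ν ‖conjR … − Y b‖²` — p1's right-hand side VERBATIM times `η⁻²`),
  **`norm_nabla115_cfgEquiv`** (sup norm: `‖∇(cfgEquiv Y)‖ = |η|⁻¹ · ‖route ∇Y‖`), `forall_norm_nabla115_le_iff` (bondwise rows);
* §3 the (115)-norm on the diagonal: **`norm_space115_diag_eq`** (generic: `lev₀ ≡ lev₁ ≡ k`, `η = L^{−k}` ⇒ `‖f‖₍₁₁₅₎ = max ‖f‖_sup ‖∇f‖_sup`, from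
  `…SectET3Transport.levWeight_const_eq_one`) and the T³ reading **`norm115_cfgEquiv_eq`** (`= max ‖Y‖ (|η|⁻¹·‖route ∇Y‖)`).
HONEST FRAMING.  Bookkeeping identities (re-indexing, one scalar); nothing of [Balaban1985Variational]∕[Balaban1985BackgroundPropagators] is asserted; the DIVERGENCE
row (`B9Eq39Adjoint.divPη` ↔ `B10Eq68TorusRegularity.covDivT`) is ★w2-19200 g2's `inU2cur_of_regPr` and is NOT typed here; `--supports stmt-QuantumFields-19200 --as helper`.

References: T. Bałaban, CMP 99 (1985) 389–434 [Balaban1985BackgroundPropagators] ((3.3) p.391); CMP 102 (1985) 277–309 [Balaban1985Variational] ((115) p.294, p.286);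
CMP 98 (1985) 17–51 [Balaban1985Averaging] ((56) p.27).
-/

set_option autoImplicit false

noncomputable section

open scoped Matrix.Norms.L2Operator BigOperators
open Literature.MathematicalPhysics.QuantumFieldTheory.Balaban1983to89
open Literature.MathematicalPhysics.QuantumFieldTheory.Balaban1983to89.T3ContinuumYM3Torus
open Literature.MathematicalPhysics.QuantumFieldTheory.Balaban1983to89.B10Eq27TorusAxialLog (toUField unitsField)
open Literature.MathematicalPhysics.QuantumFieldTheory.Balaban1983to89.B7Eq78Linearization (conjR conjR_apply)
open B9SectCLatticeCarrier (Bond)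
open B4Sect5Torus (TSite)
open B11Eq111FrakG (nabla115 nabla115_apply)
open B11Eq115Space (NegSize NegSup Space115 JetSup levWeight)
open Summit.QuantumFields.YangMills.Theorems.Prop7SectET3Transport

namespace Summit.QuantumFields.YangMills.Theorems.Prop7SectET3NablaDict

/-! ## §1 The pointwise dictionary -/

/-- **`nabla115` AT A PULLED-BACK BACKGROUND, ABSTRACT CHART**: for a site chart `e` carrying the route's `Site.shift` to the [B9] unit step, an `SU(N)` configuration `U₀`
read as the background `fun b ↦ unitsField (toUField U₀) ⟨e⁻¹ b.1, b.2⟩` and a bond function `Y` read as `fun b ↦ Y ⟨e⁻¹ b.1, b.2⟩`,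
`(∇_{U₀} Y)((e x, ν), μ) = η⁻¹ · (R(U₀(x,ν)) Y(x + e_ν, μ) − Y(x, μ))` — [B9] (3.3) is the route's `conjR` covariant difference times `η⁻¹`, indices swapped.
[cite: Balaban1985BackgroundPropagators, (3.3) p.391; Balaban1985Averaging, (56) p.27] -/
theorem nabla115_lambda_pullback_apply {P : Params} {j : ℕ} {Pd : Fin P.d → ℕ} {N : ℕ} (e : Site P j ≃ TSite P.d Pd)
    (he : ∀ (x : Site P j) (μ : Fin P.d), e (x.shift μ) = B9SectCLatticeCarrier.shift μ (e x)) (η : ℝ)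
    (U₀ : GaugeField P j (Matrix.specialUnitaryGroup (Fin N) ℂ)) (Y : PBond P j → Matrix (Fin N) (Fin N) ℂ) (x : Site P j) (ν μ : Fin P.d) :
    nabla115 η (fun b : Bond P.d Pd => unitsField (toUField U₀) ⟨e.symm b.1, b.2⟩) (fun b : Bond P.d Pd => Y ⟨e.symm b.1, b.2⟩) ((e x, ν), μ)
      = ((η : ℂ))⁻¹ • (conjR (unitsField (toUField U₀) ⟨x, ν⟩) (Y ⟨x.shift ν, μ⟩) - Y ⟨x, μ⟩) := by
  rw [nabla115_apply, conjR_apply]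
  dsimp only [B9SectCLatticeCarrier.btgt, B9SectCLatticeCarrier.bpos]
  rw [← he, Equiv.symm_apply_apply, Equiv.symm_apply_apply]

/-- **THE OWNER'S ROW — `nabla115` AT THE T³ BACKGROUND OF RECORD vs THE ROUTE'S COVARIANT DIFFERENCE**: with `bgOfCfg F K U₀`, `cfgEquiv F K _ Y` and the chart of record
`siteEquiv F K` (`…SectET3Transport`), `nabla115 η (bgOfCfg F K U₀) (cfgEquiv F K _ Y) ((siteEquiv F K x, ν), μ) = η⁻¹ • (conjR (unitsField (toUField U₀) ⟨x, ν⟩)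
(Y ⟨x.shift ν, μ⟩) − Y ⟨x, μ⟩)` — p1's letter (`…CovariantCoercivity`) times `η⁻¹`, indices swapped. [cite: Balaban1985BackgroundPropagators, (3.3) p.391] -/
theorem nabla115_bgOfCfg_cfgEquiv (F : T3Family) (K : ℕ) (η : ℝ) (U₀ : GaugeField (F.P K) 0 (Matrix.specialUnitaryGroup (Fin 2) ℂ))
    (Y : PBond (F.P K) 0 → Matrix (Fin 2) (Fin 2) ℂ) (x : Site (F.P K) 0) (ν μ : Fin 3) :
    nabla115 η (bgOfCfg F K U₀) (cfgEquiv F K _ Y) ((siteEquiv F K x, ν), μ)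
      = ((η : ℂ))⁻¹ • (conjR (unitsField (toUField U₀) ⟨x, ν⟩) (Y ⟨x.shift ν, μ⟩) - Y ⟨x, μ⟩) := by
  rw [bgOfCfg_eq, cfgEquiv_eq]
  exact nabla115_lambda_pullback_apply (siteEquiv F K) (siteEquiv_shift F K) η U₀ Y x ν μ

/-- … read at an arbitrary [B9] index `((y, ν), μ)`: `= η⁻¹ • (conjR (U₀ ⟨e⁻¹ y, ν⟩) (Y ⟨(e⁻¹ y) + e_ν, μ⟩) − Y ⟨e⁻¹ y, μ⟩)`. [cite: Balaban1985BackgroundPropagators, (3.3) p.391] -/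
theorem nabla115_bgOfCfg_cfgEquiv_apply (F : T3Family) (K : ℕ) (η : ℝ) (U₀ : GaugeField (F.P K) 0 (Matrix.specialUnitaryGroup (Fin 2) ℂ))
    (Y : PBond (F.P K) 0 → Matrix (Fin 2) (Fin 2) ℂ) (y : TSite 3 (periodsT3 F K)) (ν μ : Fin 3) :
    nabla115 η (bgOfCfg F K U₀) (cfgEquiv F K _ Y) ((y, ν), μ)
      = ((η : ℂ))⁻¹ • (conjR (unitsField (toUField U₀) ⟨(siteEquiv F K).symm y, ν⟩) (Y ⟨((siteEquiv F K).symm y).shift ν, μ⟩)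
          - Y ⟨(siteEquiv F K).symm y, μ⟩) := by
  have h := nabla115_bgOfCfg_cfgEquiv F K η U₀ Y ((siteEquiv F K).symm y) ν μ
  rwa [Equiv.apply_symm_apply] at h

/-- The `η`-cleared form (`η ≠ 0`): `η • (∇ (cfgEquiv Y))((e x, ν), μ) = conjR (U₀(x,ν)) (Y ⟨x + e_ν, μ⟩) − Y ⟨x, μ⟩` — the route's letter on the nose.
[cite: Balaban1985BackgroundPropagators, (3.3) p.391] -/
theorem eta_smul_nabla115_bgOfCfg_cfgEquiv (F : T3Family) (K : ℕ) {η : ℝ} (hη : η ≠ 0) (U₀ : GaugeField (F.P K) 0 (Matrix.specialUnitaryGroup (Fin 2) ℂ))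
    (Y : PBond (F.P K) 0 → Matrix (Fin 2) (Fin 2) ℂ) (x : Site (F.P K) 0) (ν μ : Fin 3) :
    (η : ℂ) • nabla115 η (bgOfCfg F K U₀) (cfgEquiv F K _ Y) ((siteEquiv F K x, ν), μ)
      = conjR (unitsField (toUField U₀) ⟨x, ν⟩) (Y ⟨x.shift ν, μ⟩) - Y ⟨x, μ⟩ := by
  rw [nabla115_bgOfCfg_cfgEquiv, smul_smul, mul_inv_cancel₀ (Complex.ofReal_ne_zero.2 hη), one_smul]

/-! ## §2 Sums and sup norms through the index swap -/

/-- Summing a function of the [B9] jet index `((y, ν), μ) ∈ Bond 3 Pd × Fin 3` is summing over the route's `(b, ν) ∈ PBond × Fin 3` through `(b, ν) ↦ ((e b.src, ν), b.dir)`.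
[folklore] -/
theorem sum_bond_fin_eq_sum_pbond (F : T3Family) (K : ℕ) {M : Type*} [AddCommMonoid M] (g : Bond 3 (periodsT3 F K) × Fin 3 → M) :
    ∑ q : Bond 3 (periodsT3 F K) × Fin 3, g q = ∑ b : PBond (F.P K) 0, ∑ ν : Fin (F.P K).d, g ((siteEquiv F K b.src, ν), b.dir) := by
  rw [Fintype.sum_prod_type, Fintype.sum_prod_type]
  rw [← Fintype.sum_equiv (bondEquiv F K).symm (fun p : Bond 3 (periodsT3 F K) => ∑ ν : Fin 3, g ((p.1, ν), p.2))
    (fun b : PBond (F.P K) 0 => ∑ ν : Fin (F.P K).d, g ((siteEquiv F K b.src, ν), b.dir)) fun p => by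
      simp only [bondEquiv_symm_apply, Equiv.apply_symm_apply]; rfl]
  rw [Fintype.sum_prod_type]
  exact Finset.sum_congr rfl fun y _ => Finset.sum_comm

/-- `‖η⁻¹ • v‖² = (η²)⁻¹ · ‖v‖²` for the complex scalar `((η : ℂ))⁻¹`. [folklore] -/
theorem norm_inv_eta_smul_sq {V : Type*} [SeminormedAddCommGroup V] [NormedSpace ℂ V] (η : ℝ) (v : V) :
    ‖((η : ℂ))⁻¹ • v‖ ^ 2 = (η ^ 2)⁻¹ * ‖v‖ ^ 2 := by
  rw [norm_smul, norm_inv, Complex.norm_real, Real.norm_eq_abs, mul_pow, inv_pow, sq_abs]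

/-- **THE SUM IDENTITY** (p1's right-hand side VERBATIM): `Σ_{q ∈ Bond × Fin 3} ‖(∇_{U₀}(cfgEquiv Y))(q)‖² = η⁻² · Σ_{b} Σ_{ν} ‖conjR (U₀(b.src,ν)) (Y ⟨b.src + e_ν, b.dir⟩) − Y b‖²`
— the `ℓ²` size of [B9] (3.3) at the T³ background is the route's covariant Dirichlet form of `…CovariantCoercivity.sum_normSq_le_covGrad_of_covLineAvg_eq_zero_T3` times `η⁻²`.
[cite: Balaban1985BackgroundPropagators, (3.3) p.391, Thm 3.11 p.416] -/
theorem sum_normSq_nabla115_cfgEquiv (F : T3Family) (K : ℕ) (η : ℝ) (U₀ : GaugeField (F.P K) 0 (Matrix.specialUnitaryGroup (Fin 2) ℂ))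
    (Y : PBond (F.P K) 0 → Matrix (Fin 2) (Fin 2) ℂ) :
    ∑ q : Bond 3 (periodsT3 F K) × Fin 3, ‖nabla115 η (bgOfCfg F K U₀) (cfgEquiv F K _ Y) q‖ ^ 2
      = (η ^ 2)⁻¹ * ∑ b : PBond (F.P K) 0, ∑ ν : Fin (F.P K).d, ‖conjR (unitsField (toUField U₀) ⟨b.src, ν⟩) (Y ⟨b.src.shift ν, b.dir⟩) - Y b‖ ^ 2 := by
  rw [sum_bond_fin_eq_sum_pbond, Finset.mul_sum]
  refine Finset.sum_congr rfl fun b _ => ?_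
  rw [Finset.mul_sum]
  refine Finset.sum_congr rfl fun ν _ => ?_
  rw [nabla115_bgOfCfg_cfgEquiv, norm_inv_eta_smul_sq]

/-- **THE SUP IDENTITY**: `‖∇_{U₀}(cfgEquiv Y)‖_sup = |η|⁻¹ · ‖(b, ν) ↦ conjR (U₀(b.src,ν)) (Y ⟨b.src + e_ν, b.dir⟩) − Y b‖_sup` (sup norms over `Bond × Fin 3`, resp. `PBond × Fin 3`;
re-indexing along the swap preserves the sup). [cite: Balaban1985BackgroundPropagators, (3.3) p.391; Balaban1985Variational, (115) p.294] -/
theorem norm_nabla115_cfgEquiv (F : T3Family) (K : ℕ) (η : ℝ) (U₀ : GaugeField (F.P K) 0 (Matrix.specialUnitaryGroup (Fin 2) ℂ))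
    (Y : PBond (F.P K) 0 → Matrix (Fin 2) (Fin 2) ℂ) :
    ‖nabla115 η (bgOfCfg F K U₀) (cfgEquiv F K _ Y)‖
      = |η|⁻¹ * ‖fun q : PBond (F.P K) 0 × Fin (F.P K).d => conjR (unitsField (toUField U₀) ⟨q.1.src, q.2⟩) (Y ⟨q.1.src.shift q.2, q.1.dir⟩) - Y q.1‖ := by
  -- the index swap `((y, ν), μ) ↦ (⟨e⁻¹ y, μ⟩, ν)` as an equivalence (a proof-local term, no definition)
  let σ : Bond 3 (periodsT3 F K) × Fin 3 ≃ PBond (F.P K) 0 × Fin (F.P K).d :=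
    (Equiv.prodAssoc _ _ _).trans (((Equiv.refl _).prodCongr (Equiv.prodComm _ _)).trans
      ((Equiv.prodAssoc _ _ _).symm.trans ((bondEquiv F K).symm.prodCongr (Equiv.refl _))))
  have hσ : ∀ q : Bond 3 (periodsT3 F K) × Fin 3, σ q = (⟨(siteEquiv F K).symm q.1.1, q.2⟩, q.1.2) := fun q => rfl
  have key : (nabla115 η (bgOfCfg F K U₀) (cfgEquiv F K _ Y) : Bond 3 (periodsT3 F K) × Fin 3 → Matrix (Fin 2) (Fin 2) ℂ)
      = ((η : ℂ))⁻¹ • fun q => (fun q' : PBond (F.P K) 0 × Fin (F.P K).d =>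
          conjR (unitsField (toUField U₀) ⟨q'.1.src, q'.2⟩) (Y ⟨q'.1.src.shift q'.2, q'.1.dir⟩) - Y q'.1) (σ q) := by
    funext q
    obtain ⟨⟨y, ν⟩, μ⟩ := q
    rw [Pi.smul_apply, hσ, nabla115_bgOfCfg_cfgEquiv_apply]
  rw [key, norm_smul, norm_inv, Complex.norm_real, Real.norm_eq_abs]
  congr 1
  exact norm_comp_equiv σ fun q' : PBond (F.P K) 0 × Fin (F.P K).d =>
    conjR (unitsField (toUField U₀) ⟨q'.1.src, q'.2⟩) (Y ⟨q'.1.src.shift q'.2, q'.1.dir⟩) - Y q'.1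

/-- Bondwise rows transport: `(∀ q, ‖(∇(cfgEquiv Y))(q)‖ ≤ r) ↔ ∀ b ν, |η|⁻¹·‖conjR … − Y b‖ ≤ r`. [cite: Balaban1985BackgroundPropagators, (3.3) p.391] -/
theorem forall_norm_nabla115_le_iff (F : T3Family) (K : ℕ) (η : ℝ) (U₀ : GaugeField (F.P K) 0 (Matrix.specialUnitaryGroup (Fin 2) ℂ))
    (Y : PBond (F.P K) 0 → Matrix (Fin 2) (Fin 2) ℂ) (r : ℝ) :
    (∀ q : Bond 3 (periodsT3 F K) × Fin 3, ‖nabla115 η (bgOfCfg F K U₀) (cfgEquiv F K _ Y) q‖ ≤ r)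
      ↔ ∀ (b : PBond (F.P K) 0) (ν : Fin (F.P K).d), |η|⁻¹ * ‖conjR (unitsField (toUField U₀) ⟨b.src, ν⟩) (Y ⟨b.src.shift ν, b.dir⟩) - Y b‖ ≤ r := by
  have hn : ∀ (x : Site (F.P K) 0) (ν μ : Fin 3), ‖nabla115 η (bgOfCfg F K U₀) (cfgEquiv F K _ Y) ((siteEquiv F K x, ν), μ)‖
      = |η|⁻¹ * ‖conjR (unitsField (toUField U₀) ⟨x, ν⟩) (Y ⟨x.shift ν, μ⟩) - Y ⟨x, μ⟩‖ := fun x ν μ => by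
    rw [nabla115_bgOfCfg_cfgEquiv, norm_smul, norm_inv, Complex.norm_real, Real.norm_eq_abs]
  refine ⟨fun h b ν => ?_, fun h q => ?_⟩
  · have := h ((siteEquiv F K b.src, ν), b.dir)
    rwa [hn] at this
  · obtain ⟨⟨y, ν⟩, μ⟩ := q
    have := h ⟨(siteEquiv F K).symm y, μ⟩ ν
    rw [← hn, Equiv.apply_symm_apply] at this
    exact this

/-! ## §3 The (115)-norm on the diagonal `lev ≡ k`, `η = L^{−k}` -/

/-- **THE SPACE (115) ON THE DIAGONAL IS THE PLAIN JET SUP**: with constant level maps `lev₀ ≡ lev₁ ≡ k` (pure small-field problem: every `Ω_j` the torus) and `η = L^{−k}`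
both weights `(L^kη)¹`, `(L^kη)²` are `1`, so `‖f‖₍₁₁₅₎ = max ‖f‖_sup ‖∇f‖_sup` (any linear `∇`, any index types). [cite: Balaban1985Variational, (115) p.294, p.286] -/
theorem norm_space115_diag_eq {ι κ : Type*} [Fintype ι] [Fintype κ] {V : Type*} [NormedAddCommGroup V] [NormedSpace ℂ V] {L : ℝ} [Fact (0 < L)]
    (k : ℕ) [Fact (0 < (L⁻¹) ^ k)] (D : (ι → V) →ₗ[ℂ] (κ → V)) (f : Space115 L ((L⁻¹) ^ k) (fun _ : ι => k) (fun _ : κ => k) D) :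
    ‖f‖ = max ‖JetSup.equiv _ _ D f‖ ‖D (JetSup.equiv _ _ D f)‖ := by
  rw [JetSup.norm_def, norm_negSize_const_eq k 1 (JetSup.fst f), norm_negSize_const_eq k 2 (JetSup.snd f)]
  rfl

/-- **THE T³ READING** (`norm115_cfgEquiv_eq`, OWNER 02:01:27Z): on the diagonal, an element `f` of the space (115) of the T³ background `bgOfCfg F K U₀` whose underlying bond
function is `cfgEquiv F K _ Y` has `‖f‖₍₁₁₅₎ = max ‖Y‖_sup (|η|⁻¹ · ‖route ∇_{U₀}Y‖_sup)`, `η = L^{−k}` — the route's two sup letters, the one scalar displayed.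
[cite: Balaban1985Variational, (115) p.294; Balaban1985BackgroundPropagators, (3.3) p.391] -/
theorem norm115_cfgEquiv_eq (F : T3Family) (K k : ℕ) [Fact (0 < (F.L : ℝ))] [Fact (0 < ((F.L : ℝ)⁻¹) ^ k)]
    (U₀ : GaugeField (F.P K) 0 (Matrix.specialUnitaryGroup (Fin 2) ℂ)) (Y : PBond (F.P K) 0 → Matrix (Fin 2) (Fin 2) ℂ)
    (f : Space115 (F.L : ℝ) (((F.L : ℝ)⁻¹) ^ k) (fun _ : Bond 3 (periodsT3 F K) => k) (fun _ : Bond 3 (periodsT3 F K) × Fin 3 => k)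
      (nabla115 (((F.L : ℝ)⁻¹) ^ k) (bgOfCfg F K U₀)))
    (hf : JetSup.equiv _ _ _ f = cfgEquiv F K _ Y) :
    ‖f‖ = max ‖Y‖ (|((F.L : ℝ)⁻¹) ^ k|⁻¹ *
      ‖fun q : PBond (F.P K) 0 × Fin (F.P K).d => conjR (unitsField (toUField U₀) ⟨q.1.src, q.2⟩) (Y ⟨q.1.src.shift q.2, q.1.dir⟩) - Y q.1‖) := by
  rw [norm_space115_diag_eq, hf, norm_cfgEquiv, norm_nabla115_cfgEquiv]

end Summit.QuantumFields.YangMills.Theorems.Prop7SectET3NablaDict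

end
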